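import Summits.Ventures.PercRepro.C041FourExitTools

/-!
# ROW C-041 — counting tools for the five-exit attachment (p6, gen 31; r = 5 groundwork, step (4)'s tools)

`boole_block5` (the indicator of a five-coordinate block) and `sum_prod5_ind` (the sum over the quintuple space of a
product of one-coordinate indicators is the product of the cardinalities); with `boole_and'`, `boole_block2/3/4`,
`cls_inter` of `C041FourExitTools` these give every fibre count of the five-exit attachment by the uniform script.
-/

namespace PercRepro

namespace ZoneZ

namespace TwoExit

open Finset

/-- The indicator of a five-coordinate block. -/
theorem boole_block5 {A B C D F : Type} (x : A) (y : B) (z : C) (w : D) (v : F) (S₁ S₂ : Finset A)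
    (T₁ T₂ : Finset B) (U₁ U₂ : Finset C) (W₁ W₂ : Finset D) (X₁ X₂ : Finset F) [DecidableEq A] [DecidableEq B]
    [DecidableEq C] [DecidableEq D] [DecidableEq F]
    [Decidable ((x ∈ S₁ ∧ y ∈ T₁ ∧ z ∈ U₁ ∧ w ∈ W₁ ∧ v ∈ X₁) ∨ (x ∈ S₂ ∧ y ∈ T₂ ∧ z ∈ U₂ ∧ w ∈ W₂ ∧ v ∈ X₂))] :
    (if (x ∈ S₁ ∧ y ∈ T₁ ∧ z ∈ U₁ ∧ w ∈ W₁ ∧ v ∈ X₁) ∨ (x ∈ S₂ ∧ y ∈ T₂ ∧ z ∈ U₂ ∧ w ∈ W₂ ∧ v ∈ X₂) then (1 : ℝ)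
      else 0) =
      (if x ∈ S₁ then (1 : ℝ) else 0) * (if y ∈ T₁ then 1 else 0) * (if z ∈ U₁ then 1 else 0) *
          (if w ∈ W₁ then 1 else 0) * (if v ∈ X₁ then 1 else 0) +
        (if x ∈ S₂ then (1 : ℝ) else 0) * (if y ∈ T₂ then 1 else 0) * (if z ∈ U₂ then 1 else 0) *
          (if w ∈ W₂ then 1 else 0) * (if v ∈ X₂ then 1 else 0) -
        (if x ∈ S₁ ∩ S₂ then (1 : ℝ) else 0) * (if y ∈ T₁ ∩ T₂ then 1 else 0) *
          (if z ∈ U₁ ∩ U₂ then 1 else 0) * (if w ∈ W₁ ∩ W₂ then 1 else 0) * (if v ∈ X₁ ∩ X₂ then 1 else 0) := by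
  simp only [Finset.mem_inter]
  by_cases h1 : x ∈ S₁ <;> by_cases h2 : x ∈ S₂ <;> by_cases h3 : y ∈ T₁ <;> by_cases h4 : y ∈ T₂ <;>
    by_cases h5 : z ∈ U₁ <;> by_cases h6 : z ∈ U₂ <;> by_cases h7 : w ∈ W₁ <;> by_cases h8 : w ∈ W₂ <;>
    by_cases h9 : v ∈ X₁ <;> by_cases h10 : v ∈ X₂ <;> simp [h1, h2, h3, h4, h5, h6, h7, h8, h9, h10]

/-- A sum over a five-fold product of a product of one-coordinate indicators. -/
theorem sum_prod5_ind {A B C D F : Type} [Fintype A] [Fintype B] [Fintype C] [Fintype D] [Fintype F]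
    [DecidableEq A] [DecidableEq B] [DecidableEq C] [DecidableEq D] [DecidableEq F] (S₁ : Finset A) (S₂ : Finset B)
    (S₃ : Finset C) (S₄ : Finset D) (S₅ : Finset F) :
    (∑ p : A × B × C × D × F, (if p.1 ∈ S₁ then (1 : ℝ) else 0) * (if p.2.1 ∈ S₂ then 1 else 0) *
      (if p.2.2.1 ∈ S₃ then 1 else 0) * (if p.2.2.2.1 ∈ S₄ then 1 else 0) * (if p.2.2.2.2 ∈ S₅ then 1 else 0)) =
      (#S₁ : ℝ) * #S₂ * #S₃ * #S₄ * #S₅ := by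
  have e : ∀ p : A × B × C × D × F, (if p.1 ∈ S₁ then (1 : ℝ) else 0) * (if p.2.1 ∈ S₂ then 1 else 0) *
      (if p.2.2.1 ∈ S₃ then 1 else 0) * (if p.2.2.2.1 ∈ S₄ then 1 else 0) * (if p.2.2.2.2 ∈ S₅ then 1 else 0) =
      if p ∈ S₁ ×ˢ (S₂ ×ˢ (S₃ ×ˢ (S₄ ×ˢ S₅))) then 1 else 0 := by
    intro p
    simp only [Finset.mem_product]
    rw [boole_and', boole_and', boole_and', boole_and']
    ring
  simp only [e]
  rw [Finset.sum_boole, Finset.filter_univ_mem, Finset.card_product, Finset.card_product, Finset.card_product,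
    Finset.card_product]
  push_cast
  ring

end TwoExit

end ZoneZ

end PercRepro
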